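import Mathlib
import Summits.Ventures.HodgeRepro2.T5ConductorDualBall

/-!
# EVERY CONDUCTOR EXPONENT OCCURS: `ψ(ϖ^j ·)` HAS CONDUCTOR EXPONENT `j`

Tier-5 support N3 / §G-N4.2 (seat p3, gen 84). File 327 produced a continuous non-trivial additive character of
conductor exponent `0` on every completion `K_v` (file 328: continuity gives triviality on a ball). Seat p4's shift
formula (`conductorExp_compAddMonoidHom_mulLeft`: `n(ψ(t ·)) = n(ψ) + j` for `v t = exp (−j)`) then gives one of
every conductor exponent:

* **`continuous_compAddMonoidHom_mulLeft`** — `ψ(t ·)` is continuous when `ψ` is (multiplication is continuous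
  on a valued field);
* **`exists_compAddMonoidHom_mulLeft_ne_one`** — `ψ(t ·)` is non-trivial when `ψ` is and `t ≠ 0`;
* **`exists_continuous_addChar_conductorExp_eq`** — for every `j : ℤ` there is a continuous non-trivial
  `ψ : K → S¹` with `n(ψ) = j`, as soon as some element has valuation `exp 1` (take `t = x₀^{−j}`);
  **`…_adicCompletion`** — on every `K_v`.

Nothing here is a statement about (P), theta lifts or L-values. §8(d): uses an L-value-free non-vanishing
device: NO.
-/

open IsDedekindDomain IsDedekindDomain.HeightOneSpectrum
open Summit.Ventures.HodgeRepro2.T5AdditiveConductor Summit.Ventures.HodgeRepro2.T5ConductorZeroCharacter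
  Summit.Ventures.HodgeRepro2.T5ConductorDualBall

namespace Summit.Ventures.HodgeRepro2.T5ConductorEveryExponent

section Valued

variable {K : Type*} [Field K] [Valued K (WithZero (Multiplicative ℤ))]

/-- **`ψ(t ·)` is continuous when `ψ` is** (multiplication by `t` is continuous on a valued field). -/
theorem continuous_compAddMonoidHom_mulLeft (ψ : AddChar K Circle) (hψ : Continuous ψ) (t : K) :
    Continuous (ψ.compAddMonoidHom (AddMonoidHom.mulLeft t)) := by
  have : ⇑(ψ.compAddMonoidHom (AddMonoidHom.mulLeft t)) = fun x => ψ (t * x) := by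
    funext x
    rw [AddChar.compAddMonoidHom_apply, AddMonoidHom.coe_mulLeft]
  rw [this]
  exact hψ.comp (continuous_const.mul continuous_id)

omit [Valued K (WithZero (Multiplicative ℤ))] in
/-- **`ψ(t ·)` is non-trivial when `ψ` is and `t ≠ 0`** (`ψ (t * (t⁻¹ * y)) = ψ y`). -/
theorem exists_compAddMonoidHom_mulLeft_ne_one (ψ : AddChar K Circle) (hne : ∃ y, ψ y ≠ 1) {t : K} (ht : t ≠ 0) :
    ∃ y, (ψ.compAddMonoidHom (AddMonoidHom.mulLeft t)) y ≠ 1 := by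
  obtain ⟨y, hy⟩ := hne
  refine ⟨t⁻¹ * y, ?_⟩
  rw [AddChar.compAddMonoidHom_apply, AddMonoidHom.coe_mulLeft, mul_inv_cancel_left₀ ht]
  exact hy

/-- **EVERY CONDUCTOR EXPONENT OCCURS**: with an element `x₀` of valuation `exp 1`, for every `j : ℤ` there is a
continuous non-trivial `ψ : K → S¹` with `n(ψ) = j` (file 327's character of conductor exponent `0`, composed with
multiplication by `x₀^{−j}`; p4's shift formula `n(ψ(t ·)) = n(ψ) + j` for `v t = exp (−j)`). -/
theorem exists_continuous_addChar_conductorExp_eq (x₀ : K) (hx₀ : Valued.v x₀ = WithZero.exp 1) (j : ℤ) :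
    ∃ ψ : AddChar K Circle, Continuous ψ ∧ (∃ y, ψ y ≠ 1) ∧
      conductorExp ψ (Valued.v : Valuation K (WithZero (Multiplicative ℤ))) = j := by
  obtain ⟨ψ₀, hψ₀, hne₀, h0⟩ := exists_continuous_addChar_conductorExp_eq_zero x₀ hx₀
  have hx₀ne : x₀ ≠ 0 := by
    intro h
    rw [h, map_zero] at hx₀
    exact (WithZero.exp_pos (a := (1 : ℤ))).ne hx₀
  have ht : x₀ ^ (-j) ≠ 0 := zpow_ne_zero _ hx₀ne
  have hvt : Valued.v (x₀ ^ (-j)) = WithZero.exp (-j) := by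
    rw [map_zpow₀, hx₀, ← WithZero.exp_zsmul, smul_eq_mul, mul_one]
  have hb : ∃ k : ℤ, ∀ x, Valued.v x ≤ WithZero.exp k → ψ₀ x = 1 :=
    exists_forall_le_exp_of_continuous ψ₀ hψ₀
  refine ⟨ψ₀.compAddMonoidHom (AddMonoidHom.mulLeft (x₀ ^ (-j))),
    continuous_compAddMonoidHom_mulLeft ψ₀ hψ₀ _, exists_compAddMonoidHom_mulLeft_ne_one ψ₀ hne₀ ht, ?_⟩
  rw [conductorExp_compAddMonoidHom_mulLeft ψ₀ Valued.v hb hne₀ _ ht j hvt, h0, zero_add]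

end Valued

section AdicCompletion

variable {R : Type*} [CommRing R] [IsDedekindDomain R] {K : Type*} [Field K] [Algebra R K] [IsFractionRing R K]
variable (v : HeightOneSpectrum R)

/-- **On every completion `K_v`, every conductor exponent occurs** (file 327's `exists_val_eq_exp_one`). -/
theorem exists_continuous_addChar_conductorExp_eq_adicCompletion (j : ℤ) :
    ∃ ψ : AddChar (v.adicCompletion K) Circle, Continuous ψ ∧ (∃ y, ψ y ≠ 1) ∧
      conductorExp ψ (Valued.v : Valuation (v.adicCompletion K) (WithZero (Multiplicative ℤ))) = j := by
  obtain ⟨x₀, hx₀⟩ := exists_val_eq_exp_one (K := K) v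
  exact exists_continuous_addChar_conductorExp_eq x₀ hx₀ j

end AdicCompletion

end Summit.Ventures.HodgeRepro2.T5ConductorEveryExponent
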